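import Summits.AtomisticToContinuum.HydrodynamicLimit.Theorems.LambertianContactSwapLambertianEulerKineticInputs
import Summits.AtomisticToContinuum.HydrodynamicLimit.Theorems.LambertianContactSwapLambertianEulerProductionSplitTools
import Literature.MathematicalPhysics.KineticTheory.HardSphereEulerProofs
import HarnessLib

/-!
# TL1G-Λ from its Euler-free core: Gaussian tails of the speeds imply Gaussian tails of the peculiar velocities
# (crux `LambertianEuler`, stmt-AtomisticToContinuum-11854, line `Sketch`)

Support file (`--supports stmt-AtomisticToContinuum-11854`).  Registered sub-goal `gaussianVelocityTailsLambda_of_core`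
(S2 of lead c9) of the research input TL1G-Λ (`…KineticInputs.GaussianVelocityTailsLambda`): the classical hs-Euler
solution `(ρ, u, θ)` enters TL1G-Λ only through the sup `W := sup_{r′ ∈ [0,t], x} ‖u r′ x‖ < ∞` of its (smooth, hence
continuous on the compact window `[0, t] × 𝕋³`, `t < T`) velocity field, so the EULER-FREE CORE — Gaussian `L¹` tails,
with the cubic weight, of the SPEEDS `‖v_i(r′)‖` along the Lambertian flow `Λ` from local Gibbs data, eventually in `N`,
uniformly on `[0, t]` — implies TL1G-Λ (tails of the peculiar velocities `v_i(r′) − u_{r′}(x_i(r′))`).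

## Proof

Given the core constants `A, a > 0` at the data, `σ`, `Φ`, `t`, put `A′ := (8 + A) e^{(a/4)(2W+2)²}`, `a′ := a/4`.
For a clamp level `V ≥ 1`:
* if `2W + 2 ≤ V`, then `V < ‖v − u‖`, `‖u‖ ≤ W` force `V/2 < ‖v‖`, so the TL1G integrand is termwise below the
  core integrand at level `V/2 ≥ 1`, whose expectation is `≤ A e^{−a V²/4} (N+1) ≤ A′ e^{−a′V²} (N+1)`;
* if `V < 2W + 2`, then termwise `𝟙{V < ‖v − u‖}(1+‖v‖)³ ≤ 8 + 𝟙{1 < ‖v‖}(1+‖v‖)³`, so the expectation is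
  `≤ 8(N+1) + A e^{−a}(N+1) ≤ (8 + A)(N+1) ≤ A′ e^{−a′V²}(N+1)` (the law is a probability law for `σ ≤ 1/2`).
The integral comparisons (`integral_mono_of_nonneg`) need integrability of the dominating core integrand at a
fixed time, which follows from the second and fourth Gaussian velocity moments of the local Gibbs law and the energy
monotonicity `E(Λ_r z) ≤ E(z)` (`integrable_sum_of_cubic`, the fixed-time twin of
`…ProductionSplitTools.integrable_window_functional`).

References: H.-T. Yau, Lett. Math. Phys. 22 (1991) §2 (the clamp of the cubic current); measure theory otherwise.
All `[folklore]`.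
-/

noncomputable section

namespace Summit.AtomisticToContinuum.HydrodynamicLimit.Theorems.LambertianContactSwapLambertianEulerGaussianTailsCore

open scoped BigOperators Topology ENNReal InnerProductSpace
open MeasureTheory ProbabilityTheory Filter Set InformationTheory
open Literature.MathematicalPhysics.KineticTheory
open Literature.Analysis.FluidPDE Literature.Analysis.FluidPDE.Alexander
open Summit.AtomisticToContinuum.HydrodynamicLimit.Theorems.LambertianContactSwapLambertianEulerKineticInputs
open Summit.AtomisticToContinuum.HydrodynamicLimit.Theorems.LambertianContactSwapLambertianEulerProductionSplitTools
open Summit.AtomisticToContinuum.HydrodynamicLimit.Theorems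

variable {σ : ℝ} {a₀ θ₀ : T3 → ℝ} {u₀ : T3 → V3}

/-! ## §1 Fixed-time integrability of one-body observables of cubic growth along `Λ` -/

/-- **Fixed-time integrability along `Λ`.**  Under local Gibbs data ⊗ Lambertian noise (`0 < σ < 1/2`, continuous
positive data), for a measurable one-body observable `G` with `|G(x, v)| ≤ C (1 + |v|)³`, the particle sum
`p ↦ Σ_i G((Λ_{r′} p)_i)` is integrable at every fixed time `r′` (measurability of `Λ_{r′}`, `E(Λ_{r′} z) ≤ E(z)`,
Cauchy–Schwarz, second and fourth Gaussian velocity moments). [folklore] -/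
theorem integrable_sum_of_cubic (hσ : 0 < σ) (hσ' : σ < 2⁻¹) (ha : Continuous a₀) (hθ : Continuous θ₀)
    (hu : Continuous u₀) (ha0 : ∀ x, 0 < a₀ x) (hθ0 : ∀ x, 0 < θ₀ x) (N : ℕ)
    (Φ : HardSphereFlow (Torus.geometry (Fin 3)) (hsDiameter σ N) (N + 1)) {G : T3 × V3 → ℝ} (hGm : Measurable G)
    {C : ℝ} (hC0 : 0 ≤ C) (hC : ∀ y : T3 × V3, |G y| ≤ C * (1 + ‖y.2‖) ^ 3) (r' : ℝ) :
    Integrable (fun p : Config (N + 1) (Fin 3) T3 × (ℕ → V3) => ∑ i : Fin (N + 1),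
        G (lambertFlow (Torus.geometry (Fin 3)) (hsDiameter σ N) p.2 p.1 r' i))
      ((localGibbsLaw σ a₀ u₀ θ₀ N Φ).prod (lambertNoise (Fin 3))) := by
  -- adapted from `LambertianContactSwapLambertianEulerProductionSplitTools.integrable_window_functional`
  have hσ2 : σ ≤ 1 / 2 := by rw [one_div]; exact hσ'.le
  haveI : IsProbabilityMeasure (localGibbsLaw σ a₀ u₀ θ₀ N Φ) :=
    isProbabilityMeasure_localGibbsLaw ha hθ hu ha0 hθ0 hσ2 N Φ
  set P := (localGibbsLaw σ a₀ u₀ θ₀ N Φ).prod (lambertNoise (Fin 3)) with hP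
  have hΛ := measurable_lambertFlow_hsDiameter hσ.le hσ' N r'
  have hFm : Measurable fun p : Config (N + 1) (Fin 3) T3 × (ℕ → V3) =>
      ∑ i, G (lambertFlow (Torus.geometry (Fin 3)) (hsDiameter σ N) p.2 p.1 r' i) :=
    Finset.measurable_sum _ fun i _ => hGm.comp ((measurable_pi_apply i).comp hΛ)
  have hE1 : Integrable (fun p : Config (N + 1) (Fin 3) T3 × (ℕ → V3) => ∑ i, ‖(p.1 i).2‖ ^ 2) P :=
    (QuenchedCellClock.integrable_sum_norm_sq_localGibbsLaw ha hθ hu (fun x => (ha0 x).le) hθ0 N Φ).comp_fst _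
  have hE4 : Integrable (fun p : Config (N + 1) (Fin 3) T3 × (ℕ → V3) => ∑ i, ‖(p.1 i).2‖ ^ 4) P :=
    (ClampedCurrentsDockWindowBalance.integrable_sum_norm_pow_four_localGibbsLaw ha hθ hu (fun x => (ha0 x).le)
      hθ0 σ N Φ).comp_fst _
  have hBP : Integrable (fun p : Config (N + 1) (Fin 3) T3 × (ℕ → V3) => ((N : ℝ) + 1) * C *
      (3 + 5 * ∑ i, ‖(p.1 i).2‖ ^ 2 + ((N : ℝ) + 1) * ∑ i, ‖(p.1 i).2‖ ^ 4)) P :=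
    Integrable.const_mul (((integrable_const _).add (hE1.const_mul _)).add (hE4.const_mul _)) _
  refine hBP.mono' hFm.aestronglyMeasurable (Eventually.of_forall fun p => ?_)
  have hS0 : 0 ≤ ∑ i, ‖(p.1 i).2‖ ^ 2 := Finset.sum_nonneg fun i _ => by positivity
  have hm : ∑ i, ‖(lambertFlow (Torus.geometry (Fin 3)) (hsDiameter σ N) p.2 p.1 r' i).2‖ ^ 2 ≤
      ∑ i, ‖(p.1 i).2‖ ^ 2 := by
    have h := configEnergy_lambertFlow_le (G := Torus.geometry (Fin 3)) (ε := hsDiameter σ N) p.2 p.1 r'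
    simp only [configEnergy] at h
    linarith
  have hL0 : 0 ≤ ∑ i, ‖(lambertFlow (Torus.geometry (Fin 3)) (hsDiameter σ N) p.2 p.1 r' i).2‖ ^ 2 :=
    Finset.sum_nonneg fun i _ => by positivity
  have hCS : (∑ i, ‖(p.1 i).2‖ ^ 2) ^ 2 ≤ ((N : ℝ) + 1) * ∑ i, ‖(p.1 i).2‖ ^ 4 := by
    have hcs := sq_sum_le_card_mul_sum_sq (s := Finset.univ) (f := fun i : Fin (N + 1) => ‖(p.1 i).2‖ ^ 2)
    simpa only [Finset.card_univ, Fintype.card_fin, Nat.cast_add, Nat.cast_one, ← pow_mul] using hcs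
  rw [Real.norm_eq_abs]
  refine (abs_sum_le_of_cubic hC0 hC _).trans ?_
  have hN0 : (0 : ℝ) ≤ ((N : ℝ) + 1) * C := by positivity
  refine mul_le_mul_of_nonneg_left ?_ hN0
  nlinarith [mul_le_mul hm hm hL0 hS0]

/-- The cubic speed-tail weight `𝟙{V < |v|}(1 + |v|)³` is a measurable one-body observable. [folklore] -/
theorem measurable_speedTail (V : ℝ) :
    Measurable fun y : T3 × V3 => if V < ‖y.2‖ then (1 + ‖y.2‖) ^ 3 else 0 := by
  refine Measurable.ite ?_ (by fun_prop) measurable_const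
  exact measurableSet_lt measurable_const (by fun_prop)

/-- The cubic speed-tail weight has cubic growth with constant `1`. [folklore] -/
theorem abs_speedTail_le (V : ℝ) (y : T3 × V3) :
    |(if V < ‖y.2‖ then (1 + ‖y.2‖) ^ 3 else 0 : ℝ)| ≤ 1 * (1 + ‖y.2‖) ^ 3 := by
  rw [one_mul]
  split_ifs
  · rw [abs_of_nonneg (by positivity)]
  · rw [abs_zero]; positivity

/-- **The core integrand is integrable at every fixed time**: `p ↦ Σ_i 𝟙{V < |v_i(r′)|}(1 + |v_i(r′)|)³` along `Λ`
under local Gibbs data ⊗ noise. [folklore] -/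
theorem integrable_speedTail_sum (hσ : 0 < σ) (hσ' : σ < 2⁻¹) (ha : Continuous a₀) (hθ : Continuous θ₀)
    (hu : Continuous u₀) (ha0 : ∀ x, 0 < a₀ x) (hθ0 : ∀ x, 0 < θ₀ x) (N : ℕ)
    (Φ : HardSphereFlow (Torus.geometry (Fin 3)) (hsDiameter σ N) (N + 1)) (r' V : ℝ) :
    Integrable (fun p : Config (N + 1) (Fin 3) T3 × (ℕ → V3) => ∑ i : Fin (N + 1),
        if V < ‖(lambertFlow (Torus.geometry (Fin 3)) (hsDiameter σ N) p.2 p.1 r' i).2‖ then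
          (1 + ‖(lambertFlow (Torus.geometry (Fin 3)) (hsDiameter σ N) p.2 p.1 r' i).2‖) ^ 3 else 0)
      ((localGibbsLaw σ a₀ u₀ θ₀ N Φ).prod (lambertNoise (Fin 3))) :=
  integrable_sum_of_cubic hσ hσ' ha hθ hu ha0 hθ0 N Φ (measurable_speedTail V) zero_le_one (abs_speedTail_le V) r'

/-! ## §2 The two pointwise comparisons -/

/-- **Large clamp.**  Off a large clamp the speed itself is large: `|u| ≤ W`, `2W + 2 ≤ V`, `V < |v − u|` give
`V/2 < |v|` (`|v − u| ≤ |v| + |u|`), so termwise `𝟙{V < |v − u|}(1+|v|)³ ≤ 𝟙{V/2 < |v|}(1+|v|)³`. [folklore] -/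
theorem peculiarTail_le_speedTail_half {V W : ℝ} {v u : V3} (hu : ‖u‖ ≤ W) (hV : 2 * W + 2 ≤ V) :
    (if V < ‖v - u‖ then (1 + ‖v‖) ^ 3 else 0 : ℝ) ≤ if V / 2 < ‖v‖ then (1 + ‖v‖) ^ 3 else 0 := by
  by_cases h : V < ‖v - u‖
  · have h2 : V / 2 < ‖v‖ := by
      have := norm_sub_le v u
      linarith
    rw [if_pos h, if_pos h2]
  · rw [if_neg h]
    split_ifs <;> positivity

/-- **Small clamp.**  Termwise `𝟙{V < |v − u|}(1+|v|)³ ≤ 8 + 𝟙{1 < |v|}(1+|v|)³` (split `|v| ≤ 1` / `1 < |v|`).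
[folklore] -/
theorem peculiarTail_le_eight_add_speedTail_one (V : ℝ) (v u : V3) :
    (if V < ‖v - u‖ then (1 + ‖v‖) ^ 3 else 0 : ℝ) ≤ 8 + if 1 < ‖v‖ then (1 + ‖v‖) ^ 3 else 0 := by
  split_ifs with h1 h2
  · linarith
  · have hle : 1 + ‖v‖ ≤ 2 := by linarith [not_lt.1 h2]
    have h0 : 0 ≤ 1 + ‖v‖ := by positivity
    calc (1 + ‖v‖) ^ 3 ≤ (2 : ℝ) ^ 3 := pow_le_pow_left₀ h0 hle 3
      _ = 8 + 0 := by norm_num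
  · positivity
  · norm_num

/-! ## §3 The reduction -/

/-- **TL1G-Λ FROM ITS EULER-FREE CORE.**  Gaussian `L¹` tails (cubic weight) of the speeds along `Λ` from local Gibbs
data, eventually in `N` and uniformly on `[0, t]`, imply `GaussianVelocityTailsLambda`: the Euler velocity field is
bounded by some `W` on `[0, t] × 𝕋³` (`t < T`), and a peculiar-velocity tail beyond `V` is a speed tail beyond `V/2`
once `V ≥ 2W + 2`, while for `V < 2W + 2` the claim is the trivial cubic bound plus the core at level `1`; constants
`A′ = (8 + A) e^{(a/4)(2W+2)²}`, `a′ = a/4`. [folklore] -/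
theorem gaussianVelocityTailsLambda_of_core :
    (∀ (a₀ θ₀ : T3 → ℝ) (u₀ : T3 → V3), Continuous a₀ → Continuous θ₀ → Continuous u₀ →
      (∀ x, 0 < a₀ x) → (∀ x, 0 < θ₀ x) →
      ∃ σ₀ : ℝ, 0 < σ₀ ∧ ∀ σ : ℝ, 0 < σ → σ < σ₀ →
        ∀ Φ : (N : ℕ) → HardSphereFlow (Torus.geometry (Fin 3)) (hsDiameter σ N) (N + 1),
        ∀ t : ℝ, 0 < t → ∃ A a : ℝ, 0 < A ∧ 0 < a ∧ ∀ V : ℝ, 1 ≤ V → ∃ N₀ : ℕ, ∀ N : ℕ, N₀ ≤ N →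
          ∀ r' ∈ Set.Icc 0 t,
            ∫ p, (∑ i : Fin (N + 1),
                if V < ‖(lambertFlow (Torus.geometry (Fin 3)) (hsDiameter σ N) p.2 p.1 r' i).2‖ then
                  (1 + ‖(lambertFlow (Torus.geometry (Fin 3)) (hsDiameter σ N) p.2 p.1 r' i).2‖) ^ 3 else 0)
              ∂((localGibbsLaw σ a₀ u₀ θ₀ N (Φ N)).prod (lambertNoise (Fin 3))) ≤
            A * Real.exp (-(a * V ^ 2)) * ((N : ℝ) + 1)) →
    GaussianVelocityTailsLambda := by
  intro hcore
  refine ⟨1, one_pos, fun a₀ θ₀ u₀ ha hθ hu ha0 hθ0 => ?_⟩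
  obtain ⟨σ₀, hσ₀, H⟩ := hcore a₀ θ₀ u₀ ha hθ hu ha0 hθ0
  refine ⟨min σ₀ 2⁻¹, lt_min hσ₀ (by norm_num), fun σ hσ hσlt T ρ θ u hE _ Φ _ t ht => ?_⟩
  have hσ₀' : σ < σ₀ := hσlt.trans_le (min_le_left _ _)
  have hσ' : σ < 2⁻¹ := hσlt.trans_le (min_le_right _ _)
  have hσ2 : σ ≤ 1 / 2 := by rw [one_div]; exact hσ'.le
  obtain ⟨A, a, hA, ha_, HC⟩ := H σ hσ hσ₀' Φ t ht.1
  -- the velocity bound `W` on `[0, t] × 𝕋³`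
  have h0t : (0 : ℝ) ≤ t := ht.1.le
  have hUc : Continuous fun p : ℝ × T3 => u (max 0 (min p.1 t)) p.2 :=
    continuous_clamp hE.smooth_velocity.continuousOn_stLift le_rfl h0t ht.2
  obtain ⟨W, hW0, hW⟩ := exists_forall_norm_le_window hUc 0 t
  have hWall : ∀ r' ∈ Set.Icc 0 t, ∀ x : T3, ‖u r' x‖ ≤ W := fun r' hr' x => by
    have h := hW r' hr' x
    rwa [min_eq_left hr'.2, max_eq_right hr'.1] at h
  haveI hPlam : ∀ N, IsProbabilityMeasure (localGibbsLaw σ a₀ u₀ θ₀ N (Φ N)) := fun N =>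
    isProbabilityMeasure_localGibbsLaw ha hθ hu ha0 hθ0 hσ2 N (Φ N)
  have hexp1 : 1 ≤ Real.exp (a / 4 * (2 * W + 2) ^ 2) := Real.one_le_exp (by positivity)
  -- the constants
  refine ⟨(8 + A) * Real.exp (a / 4 * (2 * W + 2) ^ 2), a / 4, by positivity, by positivity, fun V hV => ?_⟩
  by_cases hVW : 2 * W + 2 ≤ V
  · /- large clamp: compare with the core at level `V/2 ≥ 1` -/
    obtain ⟨N₀, hN₀⟩ := HC (V / 2) (by linarith)
    refine ⟨N₀, fun N hN r' hr' => ?_⟩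
    have hn : (0 : ℝ) ≤ (N : ℝ) + 1 := by positivity
    calc (∫ p, (∑ i : Fin (N + 1),
            if V < ‖(lambertFlow (Torus.geometry (Fin 3)) (hsDiameter σ N) p.2 p.1 r' i).2 -
                u r' (lambertFlow (Torus.geometry (Fin 3)) (hsDiameter σ N) p.2 p.1 r' i).1‖ then
              (1 + ‖(lambertFlow (Torus.geometry (Fin 3)) (hsDiameter σ N) p.2 p.1 r' i).2‖) ^ 3 else 0)
          ∂((localGibbsLaw σ a₀ u₀ θ₀ N (Φ N)).prod (lambertNoise (Fin 3))))
        ≤ ∫ p, (∑ i : Fin (N + 1),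
            if V / 2 < ‖(lambertFlow (Torus.geometry (Fin 3)) (hsDiameter σ N) p.2 p.1 r' i).2‖ then
              (1 + ‖(lambertFlow (Torus.geometry (Fin 3)) (hsDiameter σ N) p.2 p.1 r' i).2‖) ^ 3 else 0)
          ∂((localGibbsLaw σ a₀ u₀ θ₀ N (Φ N)).prod (lambertNoise (Fin 3))) := by
          refine integral_mono_of_nonneg (Eventually.of_forall fun p => ?_)
            (integrable_speedTail_sum hσ hσ' ha hθ hu ha0 hθ0 N (Φ N) r' (V / 2)) (Eventually.of_forall fun p => ?_)
          · exact Finset.sum_nonneg fun i _ => by positivity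
          · exact Finset.sum_le_sum fun i _ => peculiarTail_le_speedTail_half (hWall r' hr' _) hVW
      _ ≤ A * Real.exp (-(a * (V / 2) ^ 2)) * ((N : ℝ) + 1) := hN₀ N hN r' hr'
      _ ≤ (8 + A) * Real.exp (a / 4 * (2 * W + 2) ^ 2) * Real.exp (-(a / 4 * V ^ 2)) * ((N : ℝ) + 1) := by
          have h1 : Real.exp (-(a * (V / 2) ^ 2)) = Real.exp (-(a / 4 * V ^ 2)) := by
            congr 1; ring
          rw [h1]
          refine mul_le_mul_of_nonneg_right (mul_le_mul_of_nonneg_right ?_ (Real.exp_pos _).le) hn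
          nlinarith
  · /- small clamp: the trivial cubic bound plus the core at level `1` -/
    replace hVW : V < 2 * W + 2 := not_le.1 hVW
    obtain ⟨N₀, hN₀⟩ := HC 1 le_rfl
    refine ⟨N₀, fun N hN r' hr' => ?_⟩
    have hn : (0 : ℝ) ≤ (N : ℝ) + 1 := by positivity
    have hI := integrable_speedTail_sum (a₀ := a₀) (θ₀ := θ₀) (u₀ := u₀) hσ hσ' ha hθ hu ha0 hθ0 N (Φ N) r' 1
    calc (∫ p, (∑ i : Fin (N + 1),
            if V < ‖(lambertFlow (Torus.geometry (Fin 3)) (hsDiameter σ N) p.2 p.1 r' i).2 -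
                u r' (lambertFlow (Torus.geometry (Fin 3)) (hsDiameter σ N) p.2 p.1 r' i).1‖ then
              (1 + ‖(lambertFlow (Torus.geometry (Fin 3)) (hsDiameter σ N) p.2 p.1 r' i).2‖) ^ 3 else 0)
          ∂((localGibbsLaw σ a₀ u₀ θ₀ N (Φ N)).prod (lambertNoise (Fin 3))))
        ≤ ∫ p, (8 * ((N : ℝ) + 1) + ∑ i : Fin (N + 1),
            if 1 < ‖(lambertFlow (Torus.geometry (Fin 3)) (hsDiameter σ N) p.2 p.1 r' i).2‖ then
              (1 + ‖(lambertFlow (Torus.geometry (Fin 3)) (hsDiameter σ N) p.2 p.1 r' i).2‖) ^ 3 else 0)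
          ∂((localGibbsLaw σ a₀ u₀ θ₀ N (Φ N)).prod (lambertNoise (Fin 3))) := by
          refine integral_mono_of_nonneg (Eventually.of_forall fun p => ?_) ((integrable_const _).add hI)
            (Eventually.of_forall fun p => ?_)
          · exact Finset.sum_nonneg fun i _ => by positivity
          · refine (Finset.sum_le_sum fun i _ => peculiarTail_le_eight_add_speedTail_one V _ _).trans (le_of_eq ?_)
            rw [Finset.sum_add_distrib, Finset.sum_const, Finset.card_univ, Fintype.card_fin, nsmul_eq_mul,
              Nat.cast_add, Nat.cast_one, mul_comm]
      _ = 8 * ((N : ℝ) + 1) + ∫ p, (∑ i : Fin (N + 1),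
            if 1 < ‖(lambertFlow (Torus.geometry (Fin 3)) (hsDiameter σ N) p.2 p.1 r' i).2‖ then
              (1 + ‖(lambertFlow (Torus.geometry (Fin 3)) (hsDiameter σ N) p.2 p.1 r' i).2‖) ^ 3 else 0)
          ∂((localGibbsLaw σ a₀ u₀ θ₀ N (Φ N)).prod (lambertNoise (Fin 3))) := by
          rw [integral_add (integrable_const _) hI, integral_const, probReal_univ, one_smul]
      _ ≤ 8 * ((N : ℝ) + 1) + A * Real.exp (-(a * 1 ^ 2)) * ((N : ℝ) + 1) := by
          have h := hN₀ N hN r' hr'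
          linarith
      _ ≤ (8 + A) * ((N : ℝ) + 1) := by
          have h1 : Real.exp (-(a * 1 ^ 2)) ≤ 1 := Real.exp_le_one_iff.2 (by nlinarith)
          nlinarith [mul_le_mul_of_nonneg_right h1 (mul_nonneg hA.le hn)]
      _ ≤ (8 + A) * Real.exp (a / 4 * (2 * W + 2) ^ 2) * Real.exp (-(a / 4 * V ^ 2)) * ((N : ℝ) + 1) := by
          refine mul_le_mul_of_nonneg_right ?_ hn
          rw [mul_assoc, ← Real.exp_add]
          have hV0 : 0 ≤ V := zero_le_one.trans hV
          have hsq : V ^ 2 ≤ (2 * W + 2) ^ 2 := by nlinarith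
          have h1 : 1 ≤ Real.exp (a / 4 * (2 * W + 2) ^ 2 + -(a / 4 * V ^ 2)) :=
            Real.one_le_exp (by nlinarith)
          nlinarith

end Summit.AtomisticToContinuum.HydrodynamicLimit.Theorems.LambertianContactSwapLambertianEulerGaussianTailsCore
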